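import Mathlib.Analysis.InnerProductSpace.PiL2
import Mathlib.Analysis.Normed.Module.FiniteDimension
import Mathlib.MeasureTheory.Integral.Bochner.Basic
import Literature.Analysis.FunctionSpaces.PoissonPointProcess
import Literature.Probability.LatticeModels.DelaunayGraph
import Literature.Probability.LatticeModels.IsingModel
import HarnessLib

/-!
# The Ising model on the Delaunay graph of a Poisson point process: quenched and annealed
# `n`-point functions

Definition item `defn-PoissonDelaunayIsingCorr` (route `CriticalPhenomena/WeylWindow`; layer-2 children
of `WeylTransfer` — `DeviceExactSymmetry`, `CurvatureWardSmooth`, `SectorIdentification` — and card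
`conformal-poisson-devices` are stated over it): the ANNEALED `n`-point function
`pdCorr μ β n x = E_{ω ∼ PPP(μ)} ⟨∏ᵢ σ_{p_ω(xᵢ)}⟩⁺_β` of the nearest-neighbour Ising model with one
coupling on the Delaunay graph of a Poisson configuration `ω` in `ℝ³` (any proper metric space
`E` here), evaluated at the nearest points `p_ω(xᵢ)` of `ω` to the marked positions `xᵢ`
(Christ–Friedberg–Lee 1982: field theory on a random (Poisson–Delaunay) lattice; Janke–Villanova
2002: the 3D Ising model on Poisson–Voronoi/Delaunay lattices, one coupling `J`, numerically in
the Ising universality class).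

Interface, not construction — everything is a real definition over the tree's vocabulary
(`PointConfig`, `IsPoissonPointProcess` of `PoissonPointProcess.lean`; `isingExpect`, `.plus`
boundary condition, `spinMonomial` of `IsingModel.lean` / `Correlations.lean`), and NOTHING is
asserted (no named fact):

* the graph is the TREE's `delaunayGraph (ω : Set E)` (`DelaunayGraph.lean`: `p ≠ q` adjacent iff
  the empty circumscribed ball rule `IsDelaunayPair ω p q` holds — Boissonnat–Yvinec Thm 17.3.4;
  for configurations in general position, a.s. for Poisson processes with diffuse intensity, the
  `1`-skeleton of the Delaunay triangulation); not redefined here.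
* `finVolExpect ω β Λ f` — the finite-volume `+`-boundary-condition Gibbs expectation
  `⟨f⟩⁺_{Λ;β,0}` of the Ising model (coupling `1`, no field) on `delaunayGraph ω`, i.e. the tree's
  `isingExpect (delaunayGraph ω) Λ β 0 .plus f`, with the junk value `0` when the Delaunay graph
  of `ω` is not locally finite (never for configurations in general position; the tree's
  `isingExpect` needs `[LocallyFinite]`).
* `plusMonomialExpect ω β v = ⨅_{Λ ⊇ range v} ⟨∏ᵢ σ_{vᵢ}⟩⁺_{Λ;β,0}` — the **infinite-volume plus
  state** on the spin monomial of a family of vertices `v : Fin n → ω`, DEFINED as the infimum over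
  finite volumes containing the vertices: `∏ᵢ σ_{vᵢ} = σ_B` for `B` the set of vertices hit an odd
  number of times (`spinMonomial_eq_spinProduct_monomialSupport`, proved), and `Λ ↦ ⟨σ_B⟩⁺_Λ` is
  non-increasing on `Λ ⊇ B` for `β ≥ 0` (GKS; the tree's `isingCorr_plus_le_of_subset`), so the
  infimum IS the thermodynamic limit `Λ ↑ ω` (Friedli–Velenik 2017, §3.4, Thm. 3.17 / Exercise 3.12)
  — no convergence fact is needed for well-definedness.
* `nearestVertex ω hne x : ω` — a nearest point of a non-empty locally finite configuration to `x`
  (exists: `exists_nearest`, proved from local finiteness in a proper space; chosen by `choose`,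
  ties — a null event for Poisson configurations and Lebesgue-a.e. `x` — broken arbitrarily).
* `quenchedCorr ω β n x = ⟨∏ᵢ σ_{p_ω(xᵢ)}⟩⁺_{β}` (junk `0` for the empty configuration) and the
  annealed functions `annealedCorr P β n x = ∫ quenchedCorr ω β n x dP(ω)` for a law `P` on
  configurations, `pdCorr μ β n x = annealedCorr (poissonLaw μ) β n x` for an intensity measure `μ`,
  where `poissonLaw μ` is a Poisson point process law with intensity `μ` chosen by
  `Classical.epsilon` (canonical by Rényi uniqueness `IsPoissonPointProcess.unique`; junk if none
  exists — existence is the tree's fact `existsUnique_isPoissonPointProcess` for diffuse locally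
  finite `μ` on `ℝ³`).

## API (proved)

`exists_nearest`, `dist_nearestVertex_le`;
`spinMonomial_eq_spinProduct_monomialSupport` (`∏ᵢ σ_{vᵢ} = σ_{monomialSupport v}`, for ARBITRARY
vertex types — the tree's `oddSupport`/`prod_spinAt_eq_spinProduct_oddSupport` of
`GaussianPairingBound.lean` need `[Fintype V]`, unavailable for infinite configurations);
`abs_finVolExpect_spinMonomial_le_one`, `abs_plusMonomialExpect_le_one`,
`abs_quenchedCorr_le_one`, `abs_annealedCorr_le_one` (probability laws), `plusMonomialExpect_le`
(the infimum is below every finite-volume value); `isPoissonPointProcess_poissonLaw`.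

## Deliberately NOT here (construction facts, to be filed as cite items)

* Measurability of `ω ↦ quenchedCorr ω β n x` (needed for `annealedCorr` to be a genuine
  expectation rather than the Bochner junk `0`): Delaunay adjacency and nearest points are
  measurable functions of the counts.
* `β_c^{PD} ∈ (0, ∞)` for the unit-intensity homogeneous model (Peierls / percolation on the
  Delaunay graph + mean-field bound); exact invariance in law of `pdCorr (N‖x‖⁻³dx) β` under
  dilations, `O(3)` and the unit inversion, and of `pdCorr (N(1+‖x‖²)⁻³dx) β` under `O(4)` (Poisson
  mapping theorem, Last–Penrose 2017 Thm. 5.1, + Möbius-equivariance of empty spheres);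
  the identification `⨅_Λ = lim_{Λ ↑ ω}` as a `Tendsto` statement (GKS, Friedli–Velenik Thm. 3.17).

## References

* N. H. Christ, R. Friedberg, T. D. Lee, *Random lattice field theory: general formulation*,
  Nucl. Phys. B 202 (1982) 89–125. [`ChristFriedbergLee1982`]
* W. Janke, R. Villanova, *Ising model on three-dimensional random lattices: a Monte Carlo study*,
  Phys. Rev. B 66 (2002) 134208. [`JankeVillanova2002`]
* G. Last, M. Penrose, *Lectures on the Poisson process*, CUP 2017 (mapping theorem, Thm. 5.1;
  Voronoi/Delaunay mosaics). [`LastPenrose2017`]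
* S. Friedli, Y. Velenik, *Statistical mechanics of lattice systems*, CUP 2017, Ch. 3 (§3.4
  Thm. 3.17, Exercise 3.12: `+` state by GKS monotonicity). [`FriedliVelenik2017`]
-/

noncomputable section

open MeasureTheory Set Metric Filter
open scoped Topology

namespace Literature.Probability.LatticeModels

open Literature.Analysis.FunctionSpaces

/-! ### Nearest points of a locally finite configuration -/

section Nearest

variable {E : Type*} [MetricSpace E] [ProperSpace E]

/-- A non-empty locally finite configuration in a proper metric space has a nearest point to any
`x`: the points within distance `dist x p₀` of `x` form a finite non-empty set (a closed ball is
compact), which has a distance minimiser. [folklore] -/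
theorem exists_nearest (ω : PointConfig E) (hne : (ω : Set E).Nonempty) (x : E) :
    ∃ p ∈ (ω : Set E), ∀ q ∈ (ω : Set E), dist x p ≤ dist x q := by
  obtain ⟨p₀, hp₀⟩ := hne
  set F : Set E := (ω : Set E) ∩ closedBall x (dist x p₀) with hF
  have hFfin : F.Finite := by
    have := ω.finite_inter_isCompact (closedBall x (dist x p₀)) (isCompact_closedBall _ _)
    simpa [hF] using this
  have hp₀F : p₀ ∈ F := ⟨hp₀, by simp [mem_closedBall, dist_comm]⟩
  obtain ⟨p, hpF, hpmin⟩ := hFfin.exists_minimalFor (fun z => dist x z) F ⟨p₀, hp₀F⟩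
  refine ⟨p, hpF.1, fun q hq => ?_⟩
  by_cases hqF : q ∈ F
  · -- inside the ball: minimality
    by_contra hlt
    push Not at hlt
    have := hpmin hqF hlt.le
    exact absurd (le_antisymm this hlt.le) (ne_of_gt hlt)
  · -- outside the ball: farther than `p₀`, hence than `p`
    have hqfar : dist x p₀ < dist x q := by
      have : q ∉ closedBall x (dist x p₀) := fun h => hqF ⟨hq, h⟩
      rw [mem_closedBall, not_le] at this
      rwa [dist_comm q x] at this
    have hp_le : dist x p ≤ dist x p₀ := by
      by_contra hlt
      push Not at hlt
      have := hpmin hp₀F hlt.le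
      exact absurd (le_antisymm this hlt.le) (ne_of_gt hlt)
    exact hp_le.trans hqfar.le

/-- **A nearest vertex** `p_ω(x)` of the non-empty configuration `ω` to the point `x` (a choice
among the minimisers of `exists_nearest`; the tie set is Lebesgue-null in `x` for locally finite `ω`).
[cite: JankeVillanova2002, §II (spins on the sites of a Poisson–Delaunay lattice)] -/
def nearestVertex (ω : PointConfig E) (hne : (ω : Set E).Nonempty) (x : E) : (ω : Set E) :=
  ⟨(exists_nearest ω hne x).choose, (exists_nearest ω hne x).choose_spec.1⟩

/-- The chosen nearest vertex is at minimal distance from `x`. [folklore] -/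
theorem dist_nearestVertex_le (ω : PointConfig E) (hne : (ω : Set E).Nonempty) (x : E)
    {q : E} (hq : q ∈ (ω : Set E)) : dist x (nearestVertex ω hne x : E) ≤ dist x q :=
  (exists_nearest ω hne x).choose_spec.2 q hq

end Nearest

/-! ### Spin monomials are set correlations (so GKS volume-monotonicity applies) -/

section MonomialSupport

variable {V : Type*} [DecidableEq V] {n : ℕ}

/-- The set of vertices hit an ODD number of times by an indexed family `v` (since `σ_x² = 1`,
`∏ᵢ σ_{vᵢ} = σ_{monomialSupport v}`; unlike the tree's `oddSupport` no `Fintype V` is needed). [folklore] -/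
def monomialSupport (v : Fin n → V) : Finset V :=
  (Finset.univ.image v).filter fun p => Odd (Finset.univ.filter fun i => v i = p).card

/-- **`∏ᵢ σ_{vᵢ} = σ_B`** with `B = monomialSupport v`: a spin monomial with repetitions is the spin
product over the odd-multiplicity vertices (`σ_x^k = σ_x^{k mod 2}`). Hence every finite-volume
expectation of a spin monomial is a set correlation `⟨σ_B⟩`, to which the GKS inequalities apply. [folklore] -/
theorem spinMonomial_eq_spinProduct_monomialSupport (v : Fin n → V) (s : SpinConfig V) :
    spinMonomial v s = spinProduct (monomialSupport v) s := by
  classical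
  unfold spinMonomial spinProduct monomialSupport
  rw [Finset.prod_comp (s := Finset.univ) (f := fun x => spinAt x s) (g := v)]
  rw [Finset.prod_filter]
  refine Finset.prod_congr rfl fun p _ => ?_
  -- `σ_p ^ k = if Odd k then σ_p else 1`
  rcases spinAt_eq_one_or_eq_neg_one p s with h1 | h1
  · simp [h1]
  · rw [h1]
    rcases Nat.even_or_odd (Finset.univ.filter fun i => v i = p).card with he | ho
    · rw [if_neg (Nat.not_odd_iff_even.2 he), he.neg_one_pow]
    · rw [if_pos ho, ho.neg_one_pow]

end MonomialSupport

/-! ### The Ising model on the Delaunay graph of a configuration -/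

section Quenched

variable {E : Type*} [MetricSpace E]

/-- The finite-volume `+`-boundary-condition Gibbs expectation `⟨f⟩⁺_{Λ;β,0}` of the Ising model
with coupling `1` and no field on the Delaunay graph of the configuration `ω` (the tree's
`isingExpect (delaunayGraph ω) Λ β 0 .plus f`; Friedli–Velenik 2017, §3.1). Junk value `0` when the
Delaunay graph is not locally finite (a degenerate configuration; the finite-volume model needs
finitely many boundary bonds). [cite: FriedliVelenik2017, §3.1 (finite-volume Gibbs expectation)] -/
def finVolExpect (ω : PointConfig E) (β : ℝ) (Λ : Finset (ω : Set E))
    (f : SpinConfig (ω : Set E) → ℝ) : ℝ := by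
  classical
  exact if h : ∀ v, ((delaunayGraph (ω : Set E)).neighborSet v).Finite then
    haveI : (delaunayGraph (ω : Set E)).LocallyFinite := fun v => (h v).fintype
    isingExpect (delaunayGraph (ω : Set E)) Λ β 0 BoundaryCondition.plus f
  else 0

/-- Spin monomials have modulus `≤ 1`. [folklore] -/
theorem abs_spinMonomial_le_one {V : Type*} {n : ℕ} (v : Fin n → V) (s : SpinConfig V) :
    |spinMonomial v s| ≤ 1 := by
  unfold spinMonomial
  rw [Finset.abs_prod]
  refine Finset.prod_le_one (fun i _ => abs_nonneg _) fun i _ => ?_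
  rcases spinAt_eq_one_or_eq_neg_one (v i) s with h | h <;> simp [h]

/-- On any locally finite graph, `|⟨∏ᵢ σ_{vᵢ}⟩_{Λ;β,h}^{bc}| ≤ 1` (an average of a `±1`-valued
observable against a probability measure). [folklore] -/
theorem abs_isingExpect_spinMonomial_le_one {V : Type*} {G : SimpleGraph V} {_ : DecidableEq V}
    {_ : G.LocallyFinite} (Λ : Finset V) (β h : ℝ) (bc : BoundaryCondition V) {n : ℕ}
    (v : Fin n → V) : |isingExpect G Λ β h bc (spinMonomial v)| ≤ 1 := by
  unfold isingExpect
  have hbound : ∀ᵐ s ∂(isingMeasure G Λ β h bc), ‖spinMonomial v s‖ ≤ 1 :=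
    Filter.Eventually.of_forall fun s => by
      rw [Real.norm_eq_abs]
      exact abs_spinMonomial_le_one v s
  have := norm_integral_le_of_norm_le_const hbound
  simpa using this

/-- `|⟨∏ᵢ σ_{vᵢ}⟩⁺_{Λ;β,0}| ≤ 1` on the Delaunay graph (junk case `0`). [folklore] -/
theorem abs_finVolExpect_spinMonomial_le_one (ω : PointConfig E) (β : ℝ) (Λ : Finset (ω : Set E))
    {n : ℕ} (v : Fin n → (ω : Set E)) : |finVolExpect ω β Λ (spinMonomial v)| ≤ 1 := by
  classical
  unfold finVolExpect
  split_ifs with h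
  · exact abs_isingExpect_spinMonomial_le_one Λ β 0 BoundaryCondition.plus v
  · simp

/-- **The infinite-volume plus state on a spin monomial**, `⟨∏ᵢ σ_{vᵢ}⟩⁺_{β,0}` on the Delaunay
graph of `ω`, DEFINED as the infimum of the finite-volume `+` expectations over finite volumes
`Λ` containing all the `vᵢ`. Since `∏ᵢ σ_{vᵢ} = σ_B` (`B = monomialSupport v`) and
`Λ ↦ ⟨σ_B⟩⁺_{Λ;β,0}` is non-increasing on `Λ ⊇ B` for `β ≥ 0` (GKS/FKG, Friedli–Velenik 2017
Exercise 3.12 — the tree's `isingCorr_plus_le_of_subset`), this infimum is the thermodynamic limit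
`Λ ↑ ω` of Thm. 3.17; no convergence statement is needed to define it. [cite: FriedliVelenik2017, §3.4 Thm. 3.17 / Exercise 3.12] -/
def plusMonomialExpect (ω : PointConfig E) (β : ℝ) {n : ℕ} (v : Fin n → (ω : Set E)) : ℝ :=
  ⨅ Λ : {Λ : Finset (ω : Set E) // ∀ i, v i ∈ Λ}, finVolExpect ω β Λ.1 (spinMonomial v)

/-- The infimum is below every finite-volume value. [folklore] -/
theorem plusMonomialExpect_le (ω : PointConfig E) (β : ℝ) {n : ℕ} (v : Fin n → (ω : Set E))
    (Λ : Finset (ω : Set E)) (hΛ : ∀ i, v i ∈ Λ) :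
    plusMonomialExpect ω β v ≤ finVolExpect ω β Λ (spinMonomial v) := by
  refine ciInf_le ⟨-1, ?_⟩ (⟨Λ, hΛ⟩ : {Λ : Finset (ω : Set E) // ∀ i, v i ∈ Λ})
  rintro _ ⟨Λ', rfl⟩
  exact (abs_le.1 (abs_finVolExpect_spinMonomial_le_one ω β Λ'.1 v)).1

/-- `|⟨∏ᵢ σ_{vᵢ}⟩⁺_{β,0}| ≤ 1`. [folklore] -/
theorem abs_plusMonomialExpect_le_one (ω : PointConfig E) (β : ℝ) {n : ℕ} (v : Fin n → (ω : Set E)) :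
    |plusMonomialExpect ω β v| ≤ 1 := by
  classical
  have hne : Nonempty {Λ : Finset (ω : Set E) // ∀ i, v i ∈ Λ} :=
    ⟨⟨Finset.univ.image v, fun i => Finset.mem_image_of_mem v (Finset.mem_univ i)⟩⟩
  rw [abs_le]
  constructor
  · exact le_ciInf fun Λ => (abs_le.1 (abs_finVolExpect_spinMonomial_le_one ω β Λ.1 v)).1
  · obtain ⟨Λ⟩ := hne
    exact (plusMonomialExpect_le ω β v Λ.1 Λ.2).trans
      (abs_le.1 (abs_finVolExpect_spinMonomial_le_one ω β Λ.1 v)).2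

variable [ProperSpace E]

/-- **The quenched `n`-point function** `⟨∏ᵢ σ_{p_ω(xᵢ)}⟩⁺_{β}` of the plus state of the Ising
model (one coupling, no field) on the Delaunay graph of the configuration `ω`, at the nearest
vertices `p_ω(xᵢ)` of the marked positions (Janke–Villanova 2002: spins on the sites of the
Poisson–Delaunay lattice, uniform nearest-neighbour coupling). Junk value `0` for the empty
configuration. [cite: JankeVillanova2002, §II (the model)] -/
def quenchedCorr (ω : PointConfig E) (β : ℝ) (n : ℕ) (x : Fin n → E) : ℝ := by
  classical
  exact if hne : (ω : Set E).Nonempty then plusMonomialExpect ω β fun i => nearestVertex ω hne (x i)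
    else 0

/-- `|quenchedCorr ω β n x| ≤ 1`. [folklore] -/
theorem abs_quenchedCorr_le_one (ω : PointConfig E) (β : ℝ) (n : ℕ) (x : Fin n → E) :
    |quenchedCorr ω β n x| ≤ 1 := by
  classical
  unfold quenchedCorr
  split_ifs with hne
  · exact abs_plusMonomialExpect_le_one ω β _
  · simp

end Quenched

/-! ### Annealing over a Poisson point process -/

section Annealed

variable {E : Type*} [MetricSpace E] [MeasurableSpace E]

/-- **A Poisson point process law with intensity `μ`**, chosen by `Classical.epsilon` among the
probability measures `P` on locally finite configurations with `IsPoissonPointProcess μ P`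
(Kingman 1993 §2.1). Canonical: any two such laws coincide for σ-finite `μ` (Rényi uniqueness, the
tree's `IsPoissonPointProcess.unique`); one exists for every diffuse locally finite Borel `μ` on a
second countable locally compact Hausdorff space (the tree's `existsUnique_isPoissonPointProcess`).
Junk (an arbitrary measure) when no such law exists. [cite: Kingman1993, §2.1 and §2.5] -/
def poissonLaw (μ : Measure E) : Measure (PointConfig E) :=
  Classical.epsilon fun P : Measure (PointConfig E) => IsPoissonPointProcess μ P

/-- If some Poisson law with intensity `μ` exists then `poissonLaw μ` is one. [folklore] -/
theorem isPoissonPointProcess_poissonLaw {μ : Measure E}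
    (h : ∃ P : Measure (PointConfig E), IsPoissonPointProcess μ P) :
    IsPoissonPointProcess μ (poissonLaw μ) :=
  Classical.epsilon_spec h

variable [ProperSpace E]

/-- **The annealed `n`-point function** for a law `P` on configurations:
`E_{ω ∼ P} ⟨∏ᵢ σ_{p_ω(xᵢ)}⟩⁺_β = ∫ quenchedCorr ω β n x dP(ω)` (Christ–Friedberg–Lee 1982: averaging
over the random lattice). A Bochner integral: junk `0` unless `ω ↦ quenchedCorr ω β n x` is
`P`-a.e. strongly measurable (its measurability is a construction fact, not asserted here). [cite: ChristFriedbergLee1982, §2 (averaging over random lattices)] -/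
def annealedCorr (P : Measure (PointConfig E)) (β : ℝ) (n : ℕ) (x : Fin n → E) : ℝ :=
  ∫ ω, quenchedCorr ω β n x ∂P

/-- `|annealedCorr P β n x| ≤ 1` for a probability law `P` (whatever the measurability). [folklore] -/
theorem abs_annealedCorr_le_one (P : Measure (PointConfig E)) [IsProbabilityMeasure P] (β : ℝ)
    (n : ℕ) (x : Fin n → E) : |annealedCorr P β n x| ≤ 1 := by
  unfold annealedCorr
  have hbound : ∀ᵐ ω ∂P, ‖quenchedCorr ω β n x‖ ≤ 1 :=
    Filter.Eventually.of_forall fun ω => by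
      rw [Real.norm_eq_abs]
      exact abs_quenchedCorr_le_one ω β n x
  have := norm_integral_le_of_norm_le_const hbound
  simpa using this

/-- **`pdCorr μ β n x`, the annealed `n`-point function of the Poisson–Delaunay Ising model with
intensity measure `μ`** at inverse temperature `β` (coupling `1`, no field, plus state):
`E_{ω ∼ PPP(μ)} ⟨∏ᵢ σ_{p_ω(xᵢ)}⟩⁺_β`, i.e. `annealedCorr (poissonLaw μ) β n x`
(Christ–Friedberg–Lee 1982; Janke–Villanova 2002). Intensities of interest for the route:
`c · m(x) dx` with `m ∈ C²`, `m > 0`; `N‖x‖⁻³ dx`; `N(1 + ‖x‖²)⁻³ dx` on `ℝ³`. [cite: ChristFriedbergLee1982, §2] -/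
def pdCorr (μ : Measure E) (β : ℝ) (n : ℕ) (x : Fin n → E) : ℝ :=
  annealedCorr (poissonLaw μ) β n x

/-- Unfolding `pdCorr`. [folklore] -/
theorem pdCorr_eq (μ : Measure E) (β : ℝ) (n : ℕ) (x : Fin n → E) :
    pdCorr μ β n x = ∫ ω, quenchedCorr ω β n x ∂(poissonLaw μ) := rfl

/-- `|pdCorr μ β n x| ≤ 1` whenever a Poisson law with intensity `μ` exists. [folklore] -/
theorem abs_pdCorr_le_one {μ : Measure E} (h : ∃ P : Measure (PointConfig E), IsPoissonPointProcess μ P)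
    (β : ℝ) (n : ℕ) (x : Fin n → E) : |pdCorr μ β n x| ≤ 1 := by
  haveI : IsProbabilityMeasure (poissonLaw μ) := (isPoissonPointProcess_poissonLaw h).1
  exact abs_annealedCorr_le_one _ β n x

end Annealed

end Literature.Probability.LatticeModels
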